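import Summits.Ventures.HodgeRepro2.T5SU11GaussLegendre

/-!
# The Gauss–Legendre rule is sharp: for a polynomial of degree `2n` with leading coefficient `a` the error is
`a · 2/((2n + 1) lc(P_n)²) = a · 2^{2n+1} (n!)⁴ / ((2n + 1) ((2n)!)²)`

For `f` of degree `≤ 2n` write `f = q M_n + r` with the monic Legendre polynomial `M_n = P_n/lc` (row 408), `deg r < n`
and `deg q ≤ n`; the rule reproduces `∫ r` and kills nothing else, so the error is `∫ q M_n`; `q` has degree `≤ n`
and its coefficient of `Xⁿ` is the coefficient of `X^{2n}` in `f`, so `q = a M_n + (degree < n)` and `∫ q M_n = a ∫ M_n²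
= a · 2/((2n + 1) lc²)` (row 383):

  **`∫_{−1}^{1} f − Σ_i w_i f(x_i) = (coeff f (2n)) · 2/((2n + 1) · legLead n²)`** for `natDegree f ≤ 2n`
  (`gauss_legendre_error`),

which is `≠ 0` when `f` has exact degree `2n`: the exactness degree `2n − 1` of Gauss–Legendre quadrature is sharp
(`gauss_legendre_error_ne_zero`); with `lc(P_n) = (2n)!/(2ⁿ (n!)²)` (row 372) the constant is
`2^{2n+1} (n!)⁴/((2n + 1) ((2n)!)²)` (`gauss_legendre_error'`), e.g. `2/3` for `n = 1` (the midpoint rule on `x²`)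
and `8/45` for `n = 2`. Nothing is claimed about (N).

Blind lane: Mathlib + the HodgeRepro2 prefix only; no sorry; axioms ⊆ {propext, Classical.choice,
Quot.sound}.
-/

namespace Summit.Ventures.HodgeRepro2.T5SU11GaussLegendreError

open Polynomial intervalIntegral Finset Set
open T5SU11SphericalLegendreAll T5SU11JacobiPhaseLawEven T5SU11JacobiLegendreLeading T5SU11LegendreIdentities
  T5SU11LegendreOrthogonal T5SU11LegendreOrthogonalLower T5SU11LegendreZeros T5SU11GaussLegendre

/-- `∫_{−1}^{1} M_n(x)² dx = 2/((2n + 1) lc²)`. -/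
theorem integral_legMonic_sq (n : ℕ) :
    ∫ x in (-1 : ℝ)..1, (legMonic n).eval x ^ 2 = 2 / ((2 * (n : ℝ) + 1) * legLead n ^ 2) := by
  simp_rw [eval_legMonic, mul_pow]
  rw [integral_const_mul, integral_legP_sq]
  have h1 : (2 * (n : ℝ) + 1) ≠ 0 := by positivity
  have h2 : legLead n ≠ 0 := (legLead_pos n).ne'
  field_simp

/-- `M_n.coeff n = 1`. -/
theorem coeff_legMonic_self (n : ℕ) : (legMonic n).coeff n = 1 := by
  have := (legMonic_monic n).coeff_natDegree
  rwa [natDegree_legMonic] at this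

/-- **`coeff (M_n q) (2n) = coeff q n`** for `natDegree q ≤ n`. -/
theorem coeff_legMonic_mul {n : ℕ} {q : ℝ[X]} (hq : q.natDegree ≤ n) : (legMonic n * q).coeff (2 * n) = q.coeff n := by
  by_cases hq0 : q = 0
  · simp [hq0]
  rcases lt_or_eq_of_le hq with hlt | heq
  · have h1 : (legMonic n * q).natDegree < 2 * n := by
      calc (legMonic n * q).natDegree ≤ (legMonic n).natDegree + q.natDegree := natDegree_mul_le
        _ < 2 * n := by rw [natDegree_legMonic]; omega
    rw [coeff_eq_zero_of_natDegree_lt h1, coeff_eq_zero_of_natDegree_lt hlt]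
  · have := coeff_mul_degree_add_degree (legMonic n) q
    rw [natDegree_legMonic, heq, (legMonic_monic n).leadingCoeff, one_mul, leadingCoeff, heq] at this
    rw [show 2 * n = n + n by ring]
    exact this

/-- **The coefficient of `Xⁿ` in `f /ₘ M_n` is the coefficient of `X^{2n}` in `f`** (for `natDegree f ≤ 2n`). -/
theorem coeff_divByMonic_legMonic {n : ℕ} {f : ℝ[X]} (hf : f.natDegree ≤ 2 * n) :
    (f /ₘ legMonic n).coeff n = f.coeff (2 * n) := by
  have hM : (legMonic n).Monic := legMonic_monic n
  have hdiv := modByMonic_add_div f (legMonic n)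
  have hq : (f /ₘ legMonic n).natDegree ≤ n := by
    rw [natDegree_divByMonic f hM, natDegree_legMonic]
    omega
  have hrc : (f %ₘ legMonic n).coeff (2 * n) = 0 := by
    by_cases h0 : f %ₘ legMonic n = 0
    · rw [h0, coeff_zero]
    · have := degree_modByMonic_lt f hM
      rw [degree_eq_natDegree hM.ne_zero, natDegree_legMonic] at this
      exact coeff_eq_zero_of_natDegree_lt (by have := (natDegree_lt_iff_degree_lt h0).mpr this; omega)
  calc (f /ₘ legMonic n).coeff n = (legMonic n * (f /ₘ legMonic n)).coeff (2 * n) := (coeff_legMonic_mul hq).symm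
    _ = (f %ₘ legMonic n).coeff (2 * n) + (legMonic n * (f /ₘ legMonic n)).coeff (2 * n) := by rw [hrc, zero_add]
    _ = f.coeff (2 * n) := by rw [← coeff_add, hdiv]

/-- **The Gauss–Legendre error on a polynomial of degree `≤ 2n`**: `∫ f − Σ_i w_i f(x_i) = (coeff f (2n)) · 2/((2n + 1) lc²)`. -/
theorem gauss_legendre_error {n : ℕ} (hn : 1 ≤ n) {s : Finset ℝ} (hcard : s.card = n) (hs : ∀ r ∈ s, legP n r = 0)
    {f : ℝ[X]} (hf : f.natDegree ≤ 2 * n) :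
    (∫ x in (-1 : ℝ)..1, f.eval x) - ∑ i ∈ s, weight s i * f.eval i
      = f.coeff (2 * n) * (2 / ((2 * (n : ℝ) + 1) * legLead n ^ 2)) := by
  set M := legMonic n with hM
  have hMm : M.Monic := legMonic_monic n
  have hdiv := modByMonic_add_div f M
  set r := f %ₘ M with hr
  set q := f /ₘ M with hq
  have hrdeg : r.natDegree ≤ 2 * n - 1 := by
    by_cases h0 : r = 0
    · rw [h0, natDegree_zero]; omega
    · have := degree_modByMonic_lt f hMm
      rw [degree_eq_natDegree hMm.ne_zero, natDegree_legMonic] at this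
      have := (natDegree_lt_iff_degree_lt h0).mpr this
      omega
  have hqdeg : q.natDegree ≤ n := by
    rw [hq, natDegree_divByMonic f hMm, natDegree_legMonic]
    omega
  -- `q = a M_n + q'` with `a = coeff q n = coeff f (2n)` and `deg q' < n`
  set a := f.coeff (2 * n) with ha
  have hqa : q.coeff n = a := coeff_divByMonic_legMonic hf
  set q' := q - C a * M with hq'
  have hq'le : q'.natDegree ≤ n :=
    (natDegree_sub_le _ _).trans (max_le hqdeg ((natDegree_C_mul_le a M).trans (natDegree_legMonic n).le))
  have hq'n : q'.coeff n = 0 := by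
    rw [hq', coeff_sub, coeff_C_mul, hqa, hM, coeff_legMonic_self, mul_one, sub_self]
  have hq'deg : q'.natDegree < n ∨ q' = 0 := by
    by_cases h0 : q' = 0
    · exact Or.inr h0
    · left
      rcases lt_or_eq_of_le hq'le with h | h
      · exact h
      · exfalso
        apply h0
        apply leadingCoeff_eq_zero.mp
        rw [leadingCoeff, h]
        exact hq'n
  -- the integrals
  have e : ∀ x, f.eval x = r.eval x + q'.eval x * M.eval x + a * M.eval x ^ 2 := fun x => by
    conv_lhs => rw [← hdiv]
    rw [eval_add, eval_mul, show q = q' + C a * M by rw [hq']; ring, eval_add, eval_mul, eval_C]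
    ring
  have hnode : ∀ i ∈ s, f.eval i = r.eval i := fun i hi => by
    rw [e, (eval_legMonic_eq_zero_iff n i).mpr (hs i hi)]
    ring
  have hint1 : IntervalIntegrable (fun x => r.eval x) MeasureTheory.volume (-1 : ℝ) 1 :=
    r.continuous.intervalIntegrable _ _
  have hint2 : IntervalIntegrable (fun x => q'.eval x * M.eval x) MeasureTheory.volume (-1 : ℝ) 1 :=
    (q'.continuous.mul M.continuous).intervalIntegrable _ _
  have hint3 : IntervalIntegrable (fun x => a * M.eval x ^ 2) MeasureTheory.volume (-1 : ℝ) 1 :=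
    (continuous_const.mul (M.continuous.pow 2)).intervalIntegrable _ _
  have hq'int : ∫ x in (-1 : ℝ)..1, q'.eval x * M.eval x = 0 := by
    rcases hq'deg with h | h
    · exact integral_eval_mul_legMonic_eq_zero h
    · simp [h]
  have hrint : ∫ x in (-1 : ℝ)..1, r.eval x = ∑ i ∈ s, weight s i * r.eval i :=
    gauss_legendre hn hcard hs hrdeg
  simp_rw [e]
  rw [integral_add (hint1.add hint2) hint3, integral_add hint1 hint2, hq'int, add_zero, integral_const_mul,
    integral_legMonic_sq, hrint]
  have hsum : ∑ i ∈ s, weight s i * (r.eval i + q'.eval i * M.eval i + a * M.eval i ^ 2)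
      = ∑ i ∈ s, weight s i * r.eval i := by
    refine Finset.sum_congr rfl fun i hi => ?_
    rw [(eval_legMonic_eq_zero_iff n i).mpr (hs i hi)]
    ring
  rw [hsum]
  ring

/-- **The exactness degree `2n − 1` is sharp**: for `f` of exact degree `2n` the error is non-zero. -/
theorem gauss_legendre_error_ne_zero {n : ℕ} (hn : 1 ≤ n) {s : Finset ℝ} (hcard : s.card = n)
    (hs : ∀ r ∈ s, legP n r = 0) {f : ℝ[X]} (hf : f.natDegree = 2 * n) (hf0 : f ≠ 0) :
    (∫ x in (-1 : ℝ)..1, f.eval x) - ∑ i ∈ s, weight s i * f.eval i ≠ 0 := by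
  rw [gauss_legendre_error hn hcard hs hf.le]
  have h1 : f.coeff (2 * n) ≠ 0 := by
    rw [← hf]
    exact leadingCoeff_ne_zero.mpr hf0
  have h2 : (2 : ℝ) / ((2 * (n : ℝ) + 1) * legLead n ^ 2) ≠ 0 := by
    have := legLead_pos n
    positivity
  exact mul_ne_zero h1 h2

/-- **The constant in closed form**: `2/((2n + 1) lc²) = 2^{2n+1} (n!)⁴/((2n + 1) ((2n)!)²)`. -/
theorem error_constant_eq (n : ℕ) :
    2 / ((2 * (n : ℝ) + 1) * legLead n ^ 2)
      = 2 ^ (2 * n + 1) * ((n.factorial : ℝ)) ^ 4 / ((2 * (n : ℝ) + 1) * ((2 * n).factorial : ℝ) ^ 2) := by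
  rw [legLead]
  have h1 : ((2 * n).factorial : ℝ) ≠ 0 := by positivity
  have h2 : (n.factorial : ℝ) ≠ 0 := by positivity
  have h3 : (2 * (n : ℝ) + 1) ≠ 0 := by positivity
  field_simp
  ring

/-- **The Gauss–Legendre error in closed form**:
`∫ f − Σ_i w_i f(x_i) = (coeff f (2n)) · 2^{2n+1} (n!)⁴/((2n + 1) ((2n)!)²)` for `natDegree f ≤ 2n`. -/
theorem gauss_legendre_error' {n : ℕ} (hn : 1 ≤ n) {s : Finset ℝ} (hcard : s.card = n) (hs : ∀ r ∈ s, legP n r = 0)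
    {f : ℝ[X]} (hf : f.natDegree ≤ 2 * n) :
    (∫ x in (-1 : ℝ)..1, f.eval x) - ∑ i ∈ s, weight s i * f.eval i
      = f.coeff (2 * n) * (2 ^ (2 * n + 1) * ((n.factorial : ℝ)) ^ 4 / ((2 * (n : ℝ) + 1) * ((2 * n).factorial : ℝ) ^ 2)) := by
  rw [gauss_legendre_error hn hcard hs hf, error_constant_eq]

/-- The cross-checks `n = 1`: the constant is `2/3`; `n = 2`: `8/45`. -/
theorem error_constant_one_two :
    2 / ((2 * ((1 : ℕ) : ℝ) + 1) * legLead 1 ^ 2) = 2 / 3 ∧ 2 / ((2 * ((2 : ℕ) : ℝ) + 1) * legLead 2 ^ 2) = 8 / 45 := by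
  constructor
  · rw [error_constant_eq]; norm_num [Nat.factorial]
  · rw [error_constant_eq]; norm_num [Nat.factorial]

end Summit.Ventures.HodgeRepro2.T5SU11GaussLegendreError
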